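import Literature.Computability.Cryptography.UOWHFChainComposeReduction
import Literature.Computability.Cryptography.InaccessibleEntropyUOWHFBridge
import HarnessLib

/-!
# Merkle–Damgård composition at a fixed level, III: security (Goldreich 2004, Prop. 6.4.23 at one level)

Topic `Literature/Computability/Cryptography`; continues `UOWHFChainCompose.lean` (the construction `compose S`) and
`UOWHFChainComposeReduction.lean` (the machines `B0fun`, `redB`). We prove that the fixed-level Merkle–Damgård
composition of a leveled `(d, d−1)`-restricted UOWHF is a leveled `(d + R, d − 1)`-restricted UOWHF: for every
two-stage PPT adversary `(A₀, A)` against `compose S`,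

`Pr[restricted designated collision of compose S] ≤ 2^{|bin R(n)|} · Pr[(B₀, B) forms a restricted designated collision of base S]`

at every parameter `n` (`rtcrProb_compose_le`), whence negligibility transfers (`superpolynomialDecay_rtcrProb_compose`).
The proof is the planted-level argument counted in the combinatorial model of `UOWHFCombiners.lean`:

* the abstract model at level `n` — keys `Y = {0,1}^{p(n)}`, states `{0,1}^{d}`, the compression function `Gabs`
  (the basic brick, vectorised), `packV` (append the fresh bit); transport of the string chain to
  `chainState/chainOut` along the codecs (`chainSt_enc`, `chainOutStr_enc`);
* a restricted string collision of the composition is an abstract chain collision of the (length-guarded)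
  abstract adversary `(x0A, AA)` (`abs_success_of_collision`); `card_chain_success_mul_le` turns it, summed over
  the levels and multiplied by `|Y|`, into level successes; and a level-`r` success with the level code of `r` in
  `B`'s coins is a restricted string collision of `(B₀, B)` against the basic family (`collision_of_level_success`);
* the two probabilities as normalised counts over coin strings (`rtcrProb_eq_uniformAvg`, codecs), assembled in
  `rtcrProb_compose_le`.

All statements proved; no named facts.

## References

* O. Goldreich, *Foundations of Cryptography II*, CUP 2004, §6.4.3.2, Prop. 6.4.23 (proof).
* M. Naor, M. Yung, STOC 1989, Lemma 2.1; I. Damgård, CRYPTO 1989.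
-/

namespace Literature.Computability.Cryptography

namespace MDCompose

open _root_.Computability Complexity Complexity.BitCodec Complexity.Brick Polynomial Finset Filter Asymptotics
open HHRVW (catF fitLen length_fitLen fitLen_of_length_eq splice length_splice splice_append_left take_drop_append_left
  chainState chainOut chainState_congr card_chain_success_mul_le ite_le_ite_of_imp)

/-! ### The abstract model at one level -/

section Model

variable (S : Spec) (n : ℕ)

/-- The basic output length `m = d − 1` (so states have `m + 1 = d` bits). [folklore] -/
def m : ℕ := S.dL n - 1

/-- Key coins of a basic index. [folklore] -/
abbrev Yv := List.Vector Bool (S.p.eval n)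
/-- Chain states (= basic inputs), `m + 1 = d` bits. [folklore] -/
abbrev Stv := List.Vector Bool (m S n + 1)
/-- Basic outputs, `m = d − 1` bits. [folklore] -/
abbrev Ov := List.Vector Bool (m S n)
/-- One fresh bit. [folklore] -/
abbrev C1 := List.Vector Bool 1

/-- A string fitted to a vector. [folklore] -/
def vfit (k : ℕ) (l : List Bool) : List.Vector Bool k := ⟨fitLen k l, length_fitLen k l⟩

/-- **The compression function of the abstract model**: the basic brick on `⟨1ⁿ0y, st⟩`, vectorised.
[cite: Goldreich2004, Construction 6.4.22] -/
def Gabs (y : Yv S n) (st : Stv S n) : Ov S n := vfit _ (S.hb (boolPair (ones n ++ false :: y.toList) st.toList))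

/-- Appending the fresh bit. [folklore] -/
def packV (oc : Ov S n × C1) : Stv S n := ⟨oc.1.toList ++ oc.2.toList, by simp⟩

variable {S n}

/-- `m + 1 = d`. [folklore] -/
theorem m_add_one (hS : S.WF) : m S n + 1 = S.dL n := by have := hS.two_le_dL n; rw [m]; omega

/-- `packV` is injective. [folklore] -/
theorem packV_injective : Function.Injective (packV S n) := by
  rintro ⟨o, c⟩ ⟨o', c'⟩ h
  have h' := congrArg List.Vector.toList h
  simp only [packV, List.Vector.toList_mk] at h'
  obtain ⟨h1, h2⟩ := List.append_inj h' (by rw [o.toList_length, o'.toList_length])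
  rw [List.Vector.eq o o' h1, List.Vector.eq c c' h2]

/-- The value of `Gabs` as a string, on a well-formed key. [folklore] -/
theorem Gabs_toList (hS : S.WF) (y : Yv S n) (st : Stv S n) :
    (Gabs S n y st).toList = S.hb (boolPair (ones n ++ false :: y.toList) st.toList) := by
  rw [Gabs, vfit, List.Vector.toList_mk, fitLen_of_length_eq]
  rw [hS.length_hb n _ _ y.toList_length (by rw [st.toList_length, m_add_one hS]), m]

end Model

/-! ### Codecs and transport of the string chain -/

section Transport

variable (S : Spec) (n : ℕ)

/-- The codec of the `R + 1` keys. [folklore] -/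
def KC : BitCodec (Fin (S.R n + 1) → Yv S n) := (BitCodec.vector (S.p.eval n)).pi (S.R n + 1)

/-- The unused coins of a composed index. [folklore] -/
def loLen : ℕ := S.p₂.eval n - (S.R n + 1) * S.p.eval n

/-- The codec of the composed index coins: keys and leftover. [folklore] -/
def KCL : BitCodec ((Fin (S.R n + 1) → Yv S n) × List.Vector Bool (loLen S n)) := (KC S n).prod (BitCodec.vector (loLen S n))

/-- The codec of a composed input: initial state and the `R` fresh bits. [folklore] -/
def XC : BitCodec (Stv S n × (Fin (S.R n) → C1)) := (BitCodec.vector (m S n + 1)).prod ((BitCodec.vector 1).pi (S.R n))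

variable {S n}

/-- Bookkeeping lemma (codec lengths). [folklore] -/
theorem KC_len : (KC S n).len = (S.R n + 1) * S.p.eval n := by rw [KC, pi_len, vector_len]

/-- Bookkeeping lemma (codec lengths). [folklore] -/
theorem KCL_len (hS : S.WF) : (KCL S n).len = S.p₂.eval n := by
  rw [KCL, prod_len, KC_len, vector_len, loLen]; have := hS.p₂_ge n; omega

/-- Bookkeeping lemma (codec lengths). [folklore] -/
theorem XC_len (hS : S.WF) : (XC S n).len = S.dL n + S.R n := by
  rw [XC, prod_len, vector_len, pi_len, vector_len, m_add_one hS, mul_one]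

/-- The `r`-th key block of a composed index is the code of key `r`. [folklore] -/
theorem keyAt_enc (keys : Fin (S.R n + 1) → Yv S n) (lo : List.Vector Bool (loLen S n)) (r : Fin (S.R n + 1)) :
    keyAt S n ((KCL S n).enc (keys, lo)) r = (keys r).toList := by
  have h := pi_enc_block (BitCodec.vector (S.p.eval n)) (S.R n + 1) keys r
  rw [vector_len, vector_enc] at h
  have hlen : ((KC S n).enc keys).length = (S.R n + 1) * S.p.eval n := by rw [(KC S n).length_enc, KC_len]
  rw [KCL, prod_enc, vector_enc, keyAt, take_drop_append_left, KC, h]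
  rw [hlen]
  have := Nat.mul_le_mul_right (S.p.eval n) (Nat.succ_le_of_lt r.isLt)
  rw [Nat.succ_mul] at this; exact this

/-- The initial state of a composed input. [folklore] -/
theorem take_XC_enc (hS : S.WF) (st : Stv S n) (cs : Fin (S.R n) → C1) : ((XC S n).enc (st, cs)).take (S.dL n) = st.toList := by
  rw [XC, prod_enc, vector_enc, ← m_add_one hS, List.take_left' (st.toList_length)]

/-- The `r`-th fresh bit of a composed input. [folklore] -/
theorem cbit_XC_enc (hS : S.WF) (st : Stv S n) (cs : Fin (S.R n) → C1) (r : Fin (S.R n)) :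
    (((XC S n).enc (st, cs)).drop (S.dL n + r)).take 1 = (cs r).toList := by
  have h := pi_enc_block (BitCodec.vector 1) (S.R n) cs r
  rw [vector_len, vector_enc, mul_one] at h
  rw [XC, prod_enc, vector_enc, ← m_add_one hS, ← List.drop_drop, List.drop_left' (st.toList_length), h]

/-- **Transport of the chain states**: on coded keys and inputs the string states are the codes of the abstract ones.
[cite: Goldreich2004, Construction 6.4.22] -/
theorem chainSt_enc (hS : S.WF) (keys : Fin (S.R n + 1) → Yv S n) (lo : List.Vector Bool (loLen S n)) (st : Stv S n) (cs : Fin (S.R n) → C1) :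
    ∀ {r : ℕ}, r ≤ S.R n → chainSt S n ((KCL S n).enc (keys, lo)) ((XC S n).enc (st, cs)) r =
      (chainState (Gabs S n) (packV S n) (S.R n) keys st cs r).toList
  | 0, _ => by rw [chainSt, take_XC_enc hS]; rfl
  | r + 1, hr => by
    rw [chainSt, chainState, dif_pos (Nat.lt_of_succ_le hr), idxAt, keyAt_enc keys lo ⟨r, Nat.lt_succ_of_le (Nat.le_of_succ_le hr)⟩,
      chainSt_enc hS keys lo st cs (Nat.le_of_succ_le hr), ← Gabs_toList hS, cbit_XC_enc hS st cs ⟨r, Nat.lt_of_succ_le hr⟩]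
    rfl

/-- **Transport of the chained value.** [cite: Goldreich2004, Construction 6.4.22] -/
theorem chainOutStr_enc (hS : S.WF) (keys : Fin (S.R n + 1) → Yv S n) (lo : List.Vector Bool (loLen S n)) (p : Stv S n × (Fin (S.R n) → C1)) :
    chainOutStr S n ((KCL S n).enc (keys, lo)) ((XC S n).enc p) = (chainOut (Gabs S n) (packV S n) (S.R n) keys p).toList := by
  rcases p with ⟨st, cs⟩
  rw [chainOutStr, idxAt, keyAt_enc keys lo ⟨S.R n, Nat.lt_succ_self _⟩, chainSt_enc hS keys lo st cs le_rfl, ← Gabs_toList hS, chainOut]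

end Transport

/-! ### The abstract two-stage adversary and the two implications -/

section Adversary

variable (S : Spec) (n qn κ : ℕ) (A₀ : List Bool → List Bool) (A : RandAlg (List Bool) (List Bool))

/-- Target coins and leftover index coins. [folklore] -/
abbrev CoinsR := List.Vector Bool qn × List.Vector Bool (loLen S n)

/-- "has the domain length of the composition". [folklore] -/
def okLen (l : List Bool) : Prop := l.length = S.dL n + S.R n

/-- `okLen` is decidable (an equality of lengths). [folklore] -/
instance (l : List Bool) : Decidable (okLen S n l) := inferInstanceAs (Decidable (_ = _))

/-- The composed index of abstract keys and leftover coins. [folklore] -/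
def idxOf (keys : Fin (S.R n + 1) → Yv S n) (lo : List.Vector Bool (loLen S n)) : List Bool := ones n ++ false :: (KCL S n).enc (keys, lo)

/-- `A`'s answer as a string. [folklore] -/
def ansStr (keys : Fin (S.R n + 1) → Yv S n) (c : CoinsR S n qn) (ω : List.Vector Bool κ) : List Bool :=
  A.run (boolPair (unaryEncodeNat n) (boolPair (idxOf S n keys c.2) c.1.toList)) ω.toList

/-- **The abstract first stage**: the parse of `A₀(ρ)` (fitted to the domain length). [cite: Goldreich2004, proof of Prop. 6.4.23] -/
def x0A (c : CoinsR S n qn) : Stv S n × (Fin (S.R n) → C1) := (XC S n).dec (fitLen (S.dL n + S.R n) (A₀ c.1.toList))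

/-- **The abstract second stage**, length-guarded: the parse of `A`'s answer when both the target and the answer
have the domain length, and the target itself (never a collision) otherwise. [cite: Goldreich2004, proof of Prop. 6.4.23] -/
def AA (keys : Fin (S.R n + 1) → Yv S n) (c : CoinsR S n qn) (ω : List.Vector Bool κ) : Stv S n × (Fin (S.R n) → C1) :=
  if okLen S n (A₀ c.1.toList) ∧ okLen S n (ansStr S n qn κ A keys c ω) then (XC S n).dec (ansStr S n qn κ A keys c ω) else x0A S n qn A₀ c

variable {S n qn κ A₀ A}

/-- The composed index has length `M_{p₂}(n)`, hence level `n` and domain length `dL + R`. [folklore] -/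
theorem dLenC_idxOf (hS : S.WF) (keys : Fin (S.R n + 1) → Yv S n) (lo : List.Vector Bool (loLen S n)) :
    dLenC S (idxOf S n keys lo).length = S.dL n + S.R n := by
  rw [idxOf, dLenC, nOf_length_idx S.p₂ n (by rw [(KCL S n).length_enc, KCL_len hS])]

/-- **A restricted collision of the composition is an abstract chain success.** [cite: Goldreich2004, proof of Prop. 6.4.23] -/
theorem abs_success_of_collision (hS : S.WF) {keys : Fin (S.R n + 1) → Yv S n} {lo : List.Vector Bool (loLen S n)}
    {ρ : List.Vector Bool qn} {ω : List.Vector Bool κ}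
    (hc : (compose S).IsRestrictedCollision (dLenC S)
      (idxOf S n keys lo, A₀ ρ.toList, A.run (boolPair (unaryEncodeNat n) (boolPair (idxOf S n keys lo) ρ.toList)) ω.toList)) :
    AA S n qn κ A₀ A keys (ρ, lo) ω ≠ x0A S n qn A₀ (ρ, lo) ∧
      chainOut (Gabs S n) (packV S n) (S.R n) keys (AA S n qn κ A₀ A keys (ρ, lo) ω) =
        chainOut (Gabs S n) (packV S n) (S.R n) keys (x0A S n qn A₀ (ρ, lo)) := by
  simp only [HashCollection.IsRestrictedCollision] at hc
  obtain ⟨hl0, hl1, hcoll, hne⟩ := hc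
  rw [dLenC_idxOf hS] at hl0 hl1
  have hok0 : okLen S n (A₀ ρ.toList) := hl0
  have hok1 : okLen S n (ansStr S n qn κ A keys (ρ, lo) ω) := hl1
  have hAA : AA S n qn κ A₀ A keys (ρ, lo) ω = (XC S n).dec (ansStr S n qn κ A keys (ρ, lo) ω) := by rw [AA, if_pos ⟨hok0, hok1⟩]
  have hx0 : x0A S n qn A₀ (ρ, lo) = (XC S n).dec (A₀ ρ.toList) := by rw [x0A, fitLen_of_length_eq hl0]
  -- both strings are the codes of their parses
  have e0 : (XC S n).enc ((XC S n).dec (A₀ ρ.toList)) = A₀ ρ.toList := (XC S n).enc_dec _ (by rw [hl0, XC_len hS])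
  have e1 : (XC S n).enc ((XC S n).dec (ansStr S n qn κ A keys (ρ, lo) ω)) = ansStr S n qn κ A keys (ρ, lo) ω :=
    (XC S n).enc_dec _ (by rw [hok1, XC_len hS])
  rw [hAA, hx0]
  refine ⟨fun h => hne ?_, ?_⟩
  · show ansStr S n qn κ A keys (ρ, lo) ω = A₀ ρ.toList
    rw [← e1, h, e0]
  · have hkb : ((KCL S n).enc (keys, lo)).length = S.p₂.eval n := by rw [(KCL S n).length_enc, KCL_len hS]
    have h1 := compose_hash_eq S hS hkb (show (ansStr S n qn κ A keys (ρ, lo) ω).length = _ from hok1)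
    have h0 := compose_hash_eq S hS hkb hl0
    change (compose S).hash (idxOf S n keys lo) (ansStr S n qn κ A keys (ρ, lo) ω) = (compose S).hash (idxOf S n keys lo) (A₀ ρ.toList) at hcoll
    rw [idxOf] at hcoll
    rw [h1, h0] at hcoll
    rw [← e1, ← e0, chainOutStr_enc hS, chainOutStr_enc hS] at hcoll
    exact List.Vector.eq _ _ hcoll

end Adversary

/-! ### The coins of `B` and the level implication -/

section LevelB

variable (S : Spec) (q : Polynomial ℕ) (n : ℕ)

/-- The unused coins of `B`. [folklore] -/
noncomputable def jkLen : ℕ := LenPres.M (Q S q) n - (aRb S n + q.eval n + S.p₂.eval n)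

/-- **The codec of `B`'s coins** `r_B = rb ++ ρ ++ kb ++ junk`. [folklore] -/
noncomputable def RBC : BitCodec (List.Vector Bool (aRb S n) × (List.Vector Bool (q.eval n) ×
    (((Fin (S.R n + 1) → Yv S n) × List.Vector Bool (loLen S n)) × List.Vector Bool (jkLen S q n)))) :=
  (BitCodec.vector (aRb S n)).prod ((BitCodec.vector (q.eval n)).prod ((KCL S n).prod (BitCodec.vector (jkLen S q n))))

/-- The level code of `r`. [folklore] -/
def rbOfR (r : Fin (S.R n + 1)) : List.Vector Bool (aRb S n) := ⟨Complexity.natBits (aRb S n) r, Complexity.length_natBits _ _⟩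

variable {S q n}

/-- Bookkeeping lemma (codec lengths). [folklore] -/
theorem RBC_len (hS : S.WF) : (RBC S q n).len = LenPres.M (Q S q) n := by
  rw [RBC, prod_len, prod_len, prod_len, vector_len, vector_len, vector_len, KCL_len hS, jkLen]
  have := fields_le (q := q) hS n; omega

/-- Decoding the level code of `r` gives `r`. [folklore] -/
theorem bitsToNat_rbOfR (r : Fin (S.R n + 1)) : bitsToNat (rbOfR S n r).toList = r := by
  have hR : S.R n < 2 ^ aRb S n := by rw [aRb]; simpa using bitsToNat_lt (encodeNat (S.R n))
  exact Complexity.bitsToNat_natBits (lt_of_le_of_lt (Nat.le_of_lt_succ r.isLt) hR)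

/-- `rbOfR` is injective. [folklore] -/
theorem rbOfR_injective : Function.Injective (rbOfR S n) := fun r r' h => by
  apply Fin.ext; rw [← bitsToNat_rbOfR r, h, bitsToNat_rbOfR]

variable (rb : List.Vector Bool (aRb S n)) (ρ : List.Vector Bool (q.eval n)) (kl : (Fin (S.R n + 1) → Yv S n) × List.Vector Bool (loLen S n))
  (jk : List.Vector Bool (jkLen S q n))

/-- The fields of coded coins: the level. [folklore] -/
theorem iOf_RBC : iOf S n ((RBC S q n).enc (rb, ρ, kl, jk)) = min (bitsToNat rb.toList) (S.R n) := by
  rw [iOf, RBC, prod_enc, vector_enc, List.take_left' rb.toList_length]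

/-- The fields of coded coins: `ρ`. [folklore] -/
theorem ρOf_RBC : ρOf S q n ((RBC S q n).enc (rb, ρ, kl, jk)) = ρ.toList := by
  rw [ρOf, RBC, prod_enc, vector_enc, List.drop_left' rb.toList_length, prod_enc, vector_enc, List.take_left' ρ.toList_length]

/-- The fields of coded coins: the key coins. [folklore] -/
theorem kbOf_RBC (hS : S.WF) : kbOf S q n ((RBC S q n).enc (rb, ρ, kl, jk)) = (KCL S n).enc kl := by
  rw [kbOf, RBC, prod_enc, vector_enc, ← List.drop_drop, List.drop_left' rb.toList_length, prod_enc, vector_enc,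
    List.drop_left' ρ.toList_length, prod_enc, List.take_left' (by rw [(KCL S n).length_enc, KCL_len hS])]

/-- The length of coded coins. [folklore] -/
theorem length_RBC_enc (hS : S.WF) : ((RBC S q n).enc (rb, ρ, kl, jk)).length = LenPres.M (Q S q) n := by
  rw [(RBC S q n).length_enc, RBC_len hS]

/-- The coins of the challenge index `1ⁿ 0 y`. [folklore] -/
theorem ksOf_idx (n : ℕ) (y : List Bool) : ksOf n (ones n ++ false :: y) = y := by
  rw [ksOf, show ones n ++ false :: y = (ones n ++ [false]) ++ y by simp, List.drop_left' (by simp [ones])]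

/-- **Splicing the challenge into block `r` is updating key `r`.** [folklore] -/
theorem splice_KCL (r : Fin (S.R n + 1)) (y : Yv S n) (keys : Fin (S.R n + 1) → Yv S n) (lo : List.Vector Bool (loLen S n)) :
    splice (S.p.eval n) r y.toList ((KCL S n).enc (keys, lo)) = (KCL S n).enc (Function.update keys r y, lo) := by
  have hlen : ((KC S n).enc keys).length = (S.R n + 1) * S.p.eval n := by rw [(KC S n).length_enc, KC_len]
  have hb : ((r : ℕ) + 1) * S.p.eval n ≤ ((KC S n).enc keys).length := by rw [hlen]; exact Nat.mul_le_mul_right _ r.isLt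
  have hu := BitCodec.pi_enc_update (BitCodec.vector (S.p.eval n)) (S.R n + 1) keys r y
  rw [vector_len, vector_enc] at hu
  rw [KCL, prod_enc, prod_enc, vector_enc, splice_append_left hb, KC, hu]

variable {A₀ : List Bool → List Bool} {A : RandAlg (List Bool) (List Bool)} {κ : ℕ}

/-- Keys agreeing below level `r` give the same level-`r` state (the update at `r` is invisible below).
[folklore] -/
theorem chainState_update_eq (r : Fin (S.R n + 1)) (y : Yv S n) (keys : Fin (S.R n + 1) → Yv S n) (st : Stv S n) (cs : Fin (S.R n) → C1) :
    chainState (Gabs S n) (packV S n) (S.R n) (Function.update keys r y) st cs r = chainState (Gabs S n) (packV S n) (S.R n) keys st cs r :=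
  chainState_congr _ _ _ st cs fun i hi => by rw [Function.update_of_ne (fun h => by subst h; exact lt_irrefl _ hi)]

/-- **A level-`r` success of the abstract adversary, with the level code of `r` in `B`'s coins, is a restricted
designated collision of `(B₀, B)` against the basic family.** [cite: Goldreich2004, proof of Prop. 6.4.23] -/
theorem collision_of_level_success (hS : S.WF) {dB : ℕ → ℕ} (hdB : dB (LenPres.M S.p n) = S.dL n)
    (r : Fin (S.R n + 1)) (y : Yv S n) (keys : Fin (S.R n + 1) → Yv S n) (lo : List.Vector Bool (loLen S n))
    (ρ : List.Vector Bool (q.eval n)) (jk : List.Vector Bool (jkLen S q n)) (ω : List.Vector Bool κ)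
    (hsucc : chainState (Gabs S n) (packV S n) (S.R n) (Function.update keys r y)
          (AA S n (q.eval n) κ A₀ A (Function.update keys r y) (ρ, lo) ω).1 (AA S n (q.eval n) κ A₀ A (Function.update keys r y) (ρ, lo) ω).2 r ≠
        chainState (Gabs S n) (packV S n) (S.R n) keys (x0A S n (q.eval n) A₀ (ρ, lo)).1 (x0A S n (q.eval n) A₀ (ρ, lo)).2 r ∧
      Gabs S n y (chainState (Gabs S n) (packV S n) (S.R n) (Function.update keys r y)
          (AA S n (q.eval n) κ A₀ A (Function.update keys r y) (ρ, lo) ω).1 (AA S n (q.eval n) κ A₀ A (Function.update keys r y) (ρ, lo) ω).2 r) =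
        Gabs S n y (chainState (Gabs S n) (packV S n) (S.R n) keys (x0A S n (q.eval n) A₀ (ρ, lo)).1 (x0A S n (q.eval n) A₀ (ρ, lo)).2 r)) :
    (base S).IsRestrictedCollision dB (ones n ++ false :: y.toList,
      B0P S q A₀ ((RBC S q n).enc (rbOfR S n r, ρ, (keys, lo), jk)),
      (redB S q A).run (boolPair (unaryEncodeNat n) (boolPair (ones n ++ false :: y.toList) ((RBC S q n).enc (rbOfR S n r, ρ, (keys, lo), jk))))
        ω.toList) := by
  -- names
  obtain ⟨rB, hrBdef⟩ : ∃ rB, rB = (RBC S q n).enc (rbOfR S n r, ρ, (keys, lo), jk) := ⟨_, rfl⟩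
  obtain ⟨keys', hkeys'⟩ : ∃ k, k = Function.update keys r y := ⟨_, rfl⟩
  rw [← hrBdef]; rw [← hkeys'] at hsucc
  have hrB : rB.length = LenPres.M (Q S q) n := by rw [hrBdef]; exact length_RBC_enc _ _ _ _ hS
  have hi : iOf S n rB = r := by rw [hrBdef, iOf_RBC, bitsToNat_rbOfR, min_eq_left (Nat.le_of_lt_succ r.isLt)]
  have hρ : ρOf S q n rB = ρ.toList := by rw [hrBdef, ρOf_RBC]
  have hkb : kbOf S q n rB = (KCL S n).enc (keys, lo) := by rw [hrBdef, kbOf_RBC _ _ _ _ hS]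
  -- both lengths are right, or the guarded adversary returns the target (no success)
  have hok : okLen S n (A₀ ρ.toList) ∧ okLen S n (ansStr S n (q.eval n) κ A keys' (ρ, lo) ω) := by
    by_contra h
    have hAA : AA S n (q.eval n) κ A₀ A keys' (ρ, lo) ω = x0A S n (q.eval n) A₀ (ρ, lo) := by rw [AA, if_neg h]
    apply hsucc.1
    rw [hAA, hkeys', chainState_update_eq]
  have hAA : AA S n (q.eval n) κ A₀ A keys' (ρ, lo) ω = (XC S n).dec (ansStr S n (q.eval n) κ A keys' (ρ, lo) ω) := by rw [AA, if_pos hok]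
  have hx0 : x0A S n (q.eval n) A₀ (ρ, lo) = (XC S n).dec (A₀ ρ.toList) := by rw [x0A, fitLen_of_length_eq hok.1]
  have e0 : (XC S n).enc ((XC S n).dec (A₀ ρ.toList)) = A₀ ρ.toList := (XC S n).enc_dec _ (by rw [hok.1, XC_len hS])
  have e1 : (XC S n).enc ((XC S n).dec (ansStr S n (q.eval n) κ A keys' (ρ, lo) ω)) = ansStr S n (q.eval n) κ A keys' (ρ, lo) ω :=
    (XC S n).enc_dec _ (by rw [hok.2, XC_len hS])
  -- the first stage
  have hB0 : B0P S q A₀ rB = (chainState (Gabs S n) (packV S n) (S.R n) keys (x0A S n (q.eval n) A₀ (ρ, lo)).1 (x0A S n (q.eval n) A₀ (ρ, lo)).2 r).toList := by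
    rw [B0P_apply S q A₀ hS hrB (by rw [hρ]; exact hok.1), B0fun, hrB, nOf_Q, tgt, hkb, hρ, hi, ← e0, hx0, ← chainSt_enc hS keys lo _ _ (Nat.le_of_lt_succ r.isLt)]
  -- the spliced keys are the updated keys
  have hkbS : kbS S q n (ones n ++ false :: y.toList) rB = (KCL S n).enc (keys', lo) := by
    rw [kbS, hi, ksOf_idx, hkb, splice_KCL, hkeys']
  have hxA : xA S q A n (ones n ++ false :: y.toList) rB ω.toList = ansStr S n (q.eval n) κ A keys' (ρ, lo) ω := by
    rw [xA, sbar, hkbS, hρ, ansStr, idxOf]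
  -- the second stage
  have hB : (redB S q A).run (boolPair (unaryEncodeNat n) (boolPair (ones n ++ false :: y.toList) rB)) ω.toList =
      (chainState (Gabs S n) (packV S n) (S.R n) keys' (AA S n (q.eval n) κ A₀ A keys' (ρ, lo) ω).1 (AA S n (q.eval n) κ A₀ A keys' (ρ, lo) ω).2 r).toList := by
    rw [redB_run hS hrB (by rw [ksOf_idx, y.toList_length]) (by rw [hxA]; exact hok.2), outB, hkbS, hxA, hi, ← e1, hAA,
      ← chainSt_enc hS keys' lo _ _ (Nat.le_of_lt_succ r.isLt)]
  -- the collision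
  have hsL : (ones n ++ false :: y.toList).length = LenPres.M S.p n := by simp [ones, LenPres.M]; ring
  refine ⟨?_, ?_, ?_, ?_⟩
  · show (B0P S q A₀ rB).length = dB (ones n ++ false :: y.toList).length
    rw [hB0, List.Vector.toList_length, hsL, hdB, m_add_one hS]
  · show ((redB S q A).run _ ω.toList).length = dB (ones n ++ false :: y.toList).length
    rw [hB, List.Vector.toList_length, hsL, hdB, m_add_one hS]
  · show S.hb (boolPair (ones n ++ false :: y.toList) ((redB S q A).run _ ω.toList)) = S.hb (boolPair (ones n ++ false :: y.toList) (B0P S q A₀ rB))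
    rw [hB, hB0, ← Gabs_toList hS, ← Gabs_toList hS, hsucc.2]
  · show (redB S q A).run _ ω.toList ≠ B0P S q A₀ rB
    rw [hB, hB0]
    exact fun h => hsucc.1 (List.Vector.eq _ _ h)

end LevelB

/-! ### The counting bridge -/

section Count

variable (S : Spec) (q : Polynomial ℕ) (A₀ : List Bool → List Bool) (A : RandAlg (List Bool) (List Bool))

/-- The coin polynomial of the first stage of `B`: `M_Q(n) = Q(n) + n + 1` coins. [folklore] -/
noncomputable def QB : Polynomial ℕ := Q S q + Polynomial.X + 1

variable {S q A₀ A}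

/-- `QB(n) = M_Q(n)`. [folklore] -/
theorem QB_eval (n : ℕ) : (QB S q).eval n = LenPres.M (Q S q) n := by
  simp [QB, LenPres.M]

/-- Re-indexing `B`'s success tuples: `(((ρ, (kl, jk)), y), ω) ↦ (jk, (y, kl.1, (ρ, kl.2), ω))`. [folklore] -/
def reixB (S : Spec) (q : Polynomial ℕ) (n κ : ℕ) :
    ((List.Vector Bool (q.eval n) × (((Fin (S.R n + 1) → Yv S n) × List.Vector Bool (loLen S n)) × List.Vector Bool (jkLen S q n))) ×
        Yv S n) × List.Vector Bool κ ≃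
      List.Vector Bool (jkLen S q n) × (Yv S n × (Fin (S.R n + 1) → Yv S n) × CoinsR S n (q.eval n) × List.Vector Bool κ) where
  toFun := fun ⟨⟨⟨ρ, ⟨keys, lo⟩, jk⟩, y⟩, ω⟩ => (jk, (y, keys, (ρ, lo), ω))
  invFun := fun ⟨jk, y, keys, ⟨ρ, lo⟩, ω⟩ => (((ρ, (keys, lo), jk), y), ω)
  left_inv := fun ⟨⟨⟨_, ⟨_, _⟩, _⟩, _⟩, _⟩ => rfl
  right_inv := fun ⟨_, _, _, ⟨_, _⟩, _⟩ => rfl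

/-- Counting an event of the second component over a product. [folklore] -/
theorem sum_ite_snd_eq {α β : Type*} [Fintype α] [Fintype β] (P : β → Prop) [DecidablePred P] :
    ∑ w : α × β, (if P w.2 then (1 : ℝ) else 0) = Fintype.card α * (((univ : Finset β).filter P).card : ℝ) := by
  rw [Fintype.sum_prod_type, Finset.natCast_card_filter]
  show ∑ _x : α, ∑ y : β, (if P y then (1 : ℝ) else 0) = _
  rw [Finset.sum_const, Finset.card_univ, nsmul_eq_mul]

/-- **The counting bridge** (Prop. 6.4.23 at one level, quantitatively): at every parameter,
`Pr[restricted designated collision of compose S by (A₀, A)] ≤ 2^{|bin R(n)|} · Pr[restricted designated collision of base S by (B₀, B)]`.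
[cite: Goldreich2004, proof of Prop. 6.4.23] -/
theorem rtcrProb_compose_le (hS : S.WF) {dB : ℕ → ℕ} (hdB : ∀ n, dB (LenPres.M S.p n) = S.dL n) (n : ℕ) :
    (compose S).rtcrProb (dLenC S) (fun m => q.eval m) A₀ A n ≤
      2 ^ aRb S n * (base S).rtcrProb dB (fun m => (QB S q).eval m) (B0P S q A₀) (redB S q A) n := by
  classical
  -- names for the sizes
  set κ := A.coinLen (lenA2 S q n) with hκ
  set qn := q.eval n with hqn
  -- Step 1: the composed probability as a normalised count over `(ρ, ys, ω)`
  let IS : List.Vector Bool qn → List.Vector Bool (KCL S n).len → List.Vector Bool κ → ℝ := fun ρ ys ω =>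
    if (compose S).IsRestrictedCollision (dLenC S)
        ((compose S).index.run n ys.toList, A₀ ρ.toList,
          A.run (boolPair (unaryEncodeNat n) (boolPair ((compose S).index.run n ys.toList) ρ.toList)) ω.toList) then 1 else 0
  have hrun2 : ∀ ys : List.Vector Bool (KCL S n).len, (compose S).index.run n ys.toList = ones n ++ false :: ys.toList :=
    fun ys => pShaped_index_run _ _ _ _
  have hlenA : ∀ (ρ : List.Vector Bool qn) (ys : List.Vector Bool (KCL S n).len),
      (boolPair (unaryEncodeNat n) (boolPair ((compose S).index.run n ys.toList) ρ.toList)).length = lenA2 S q n := by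
    intro ρ ys
    simp only [lenA2, length_boolPair, hrun2, ones, List.length_append, List.length_replicate, List.length_cons,
      List.Vector.toList_length, KCL_len hS, LenPres.M]; ring
  have hmid : (compose S).index.coinLen (unaryEncodeNat n).length = (KCL S n).len := by
    rw [compose_index_coinLen, unaryEncodeNat_eq_replicate, List.length_replicate, KCL_len hS]
  have h1 : (compose S).rtcrProb (dLenC S) (fun m => q.eval m) A₀ A n =
      (∑ ρ : List.Vector Bool qn, ∑ ys : List.Vector Bool (KCL S n).len, ∑ ω : List.Vector Bool κ, IS ρ ys ω) /
        (2 ^ qn * 2 ^ (KCL S n).len * 2 ^ κ) := by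
    rw [HashCollection.rtcrProb_eq_uniformAvg, hmid, uniformAvg]
    have hρ : ∀ ρ : List.Vector Bool qn, uniformAvg (KCL S n).len (fun rI => uniformAvg
        (A.coinLen (boolPair (unaryEncodeNat n) (boolPair ((compose S).index.run n rI) ρ.toList)).length)
        (fun rA => if (compose S).IsRestrictedCollision (dLenC S)
          ((compose S).index.run n rI, A₀ ρ.toList, A.run (boolPair (unaryEncodeNat n) (boolPair ((compose S).index.run n rI) ρ.toList)) rA)
          then (1 : ℝ) else 0)) = (∑ ys : List.Vector Bool (KCL S n).len, (∑ ω : List.Vector Bool κ, IS ρ ys ω) / 2 ^ κ) / 2 ^ (KCL S n).len := by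
      intro ρ
      rw [uniformAvg, Finset.sum_congr rfl fun ys _ => by rw [hlenA ρ ys, ← hκ, uniformAvg]]
    rw [Finset.sum_congr rfl fun ρ _ => hρ ρ]
    simp only [← Finset.sum_div]
    rw [div_div, div_div]
    refine congrArg₂ (· / ·) rfl ?_
    ring
  -- Step 2: a restricted collision is an abstract chain success
  let E : (Fin (S.R n + 1) → Yv S n) × CoinsR S n qn × List.Vector Bool κ → Prop := fun z =>
    AA S n qn κ A₀ A z.1 z.2.1 z.2.2 ≠ x0A S n qn A₀ z.2.1 ∧
      chainOut (Gabs S n) (packV S n) (S.R n) z.1 (AA S n qn κ A₀ A z.1 z.2.1 z.2.2) = chainOut (Gabs S n) (packV S n) (S.R n) z.1 (x0A S n qn A₀ z.2.1)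
  have h2 : ∀ (ρ : List.Vector Bool qn) (ys : List.Vector Bool (KCL S n).len) (ω : List.Vector Bool κ), IS ρ ys ω ≤
      (if E (((KCL S n).dec ys.toList).1, (ρ, ((KCL S n).dec ys.toList).2), ω) then 1 else 0) := by
    intro ρ ys ω
    refine ite_le_ite_of_imp fun hc => ?_
    have hsplit : (KCL S n).enc ((KCL S n).dec ys.toList) = ys.toList := (KCL S n).enc_dec ys.toList (List.Vector.toList_length ys)
    have hidx : (compose S).index.run n ys.toList = idxOf S n ((KCL S n).dec ys.toList).1 ((KCL S n).dec ys.toList).2 := by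
      rw [hrun2, idxOf, Prod.mk.eta, hsplit]
    rw [hidx] at hc
    exact abs_success_of_collision hS hc
  -- Step 3: the count `C₀` of abstract chain successes
  let C₀ := ((univ : Finset ((Fin (S.R n + 1) → Yv S n) × CoinsR S n qn × List.Vector Bool κ)).filter E).card
  have h3 : ∑ ρ : List.Vector Bool qn, ∑ ys : List.Vector Bool (KCL S n).len, ∑ ω : List.Vector Bool κ, IS ρ ys ω ≤ C₀ := by
    calc ∑ ρ : List.Vector Bool qn, ∑ ys : List.Vector Bool (KCL S n).len, ∑ ω : List.Vector Bool κ, IS ρ ys ω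
        ≤ ∑ ρ : List.Vector Bool qn, ∑ ys : List.Vector Bool (KCL S n).len, ∑ ω : List.Vector Bool κ,
            (if E (((KCL S n).dec ys.toList).1, (ρ, ((KCL S n).dec ys.toList).2), ω) then (1 : ℝ) else 0) :=
          Finset.sum_le_sum fun ρ _ => Finset.sum_le_sum fun ys _ => Finset.sum_le_sum fun ω _ => h2 ρ ys ω
      _ = ∑ ρ : List.Vector Bool qn, ∑ kl : (Fin (S.R n + 1) → Yv S n) × List.Vector Bool (loLen S n), ∑ ω : List.Vector Bool κ,
            (if E (kl.1, (ρ, kl.2), ω) then (1 : ℝ) else 0) := by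
          refine Finset.sum_congr rfl fun ρ _ => ?_
          rw [(KCL S n).sum_vector_eq (fun l => ∑ ω : List.Vector Bool κ, if E (((KCL S n).dec l).1, (ρ, ((KCL S n).dec l).2), ω) then (1 : ℝ) else 0)]
          refine Finset.sum_congr rfl fun kl _ => ?_
          rw [(KCL S n).dec_enc]
      _ = ∑ z : (Fin (S.R n + 1) → Yv S n) × CoinsR S n qn × List.Vector Bool κ, (if E z then (1 : ℝ) else 0) := by
          simp only [Fintype.sum_prod_type]
          rw [Finset.sum_comm]
      _ = C₀ := by rw [Finset.natCast_card_filter]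
  -- Step 4: planting a level (`× |Y|`, summed over the levels)
  have h4 := card_chain_success_mul_le (Gabs S n) (packV S n) (S.R n) packV_injective (x0A S n qn A₀) (AA S n qn κ A₀ A)
  -- Step 5: `B`'s probability as a normalised count over `(r_B, y, ω)`
  let IB : List.Vector Bool (RBC S q n).len → Yv S n → List.Vector Bool κ → ℝ := fun rB y ω =>
    if (base S).IsRestrictedCollision dB
        ((base S).index.run n y.toList, B0P S q A₀ rB.toList,
          (redB S q A).run (boolPair (unaryEncodeNat n) (boolPair ((base S).index.run n y.toList) rB.toList)) ω.toList) then 1 else 0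
  have hrun1 : ∀ y : Yv S n, (base S).index.run n y.toList = ones n ++ false :: y.toList := fun y => pShaped_index_run _ _ _ _
  have hκB : ∀ (rB : List.Vector Bool (RBC S q n).len) (y : Yv S n),
      (redB S q A).coinLen (boolPair (unaryEncodeNat n) (boolPair ((base S).index.run n y.toList) rB.toList)).length = κ := by
    intro rB y
    rw [redB_coinLen (A := A) n (by rw [hrun1]; simp [ones, LenPres.M]; ring) (by rw [List.Vector.toList_length, RBC_len hS])]
  have hmidB : (base S).index.coinLen (unaryEncodeNat n).length = S.p.eval n := by
    show S.p.eval (unaryEncodeNat n).length = _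
    rw [unaryEncodeNat_eq_replicate, List.length_replicate]
  have h5 : (base S).rtcrProb dB (fun m => (QB S q).eval m) (B0P S q A₀) (redB S q A) n =
      (∑ rB : List.Vector Bool (RBC S q n).len, ∑ y : Yv S n, ∑ ω : List.Vector Bool κ, IB rB y ω) /
        (2 ^ (RBC S q n).len * 2 ^ S.p.eval n * 2 ^ κ) := by
    rw [HashCollection.rtcrProb_eq_uniformAvg, hmidB, QB_eval, ← RBC_len (q := q) hS, uniformAvg]
    have hrB : ∀ rB : List.Vector Bool (RBC S q n).len, uniformAvg (S.p.eval n) (fun rI => uniformAvg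
        ((redB S q A).coinLen (boolPair (unaryEncodeNat n) (boolPair ((base S).index.run n rI) rB.toList)).length)
        (fun rA => if (base S).IsRestrictedCollision dB
          ((base S).index.run n rI, B0P S q A₀ rB.toList, (redB S q A).run (boolPair (unaryEncodeNat n) (boolPair ((base S).index.run n rI) rB.toList)) rA)
          then (1 : ℝ) else 0)) = (∑ y : Yv S n, (∑ ω : List.Vector Bool κ, IB rB y ω) / 2 ^ κ) / 2 ^ S.p.eval n := by
      intro rB
      rw [uniformAvg, Finset.sum_congr rfl fun y _ => by rw [hκB rB y, uniformAvg]]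
    rw [Finset.sum_congr rfl fun rB _ => hrB rB]
    simp only [← Finset.sum_div]
    rw [div_div, div_div]
    refine congrArg₂ (· / ·) rfl ?_
    ring
  -- Step 6: level successes are collisions of `B`
  have h6 : ∀ r : Fin (S.R n + 1),
      (((univ : Finset (Yv S n × (Fin (S.R n + 1) → Yv S n) × CoinsR S n qn × List.Vector Bool κ)).filter fun z =>
      (chainState (Gabs S n) (packV S n) (S.R n) (Function.update z.2.1 r z.1)
        (AA S n qn κ A₀ A (Function.update z.2.1 r z.1) z.2.2.1 z.2.2.2).1 (AA S n qn κ A₀ A (Function.update z.2.1 r z.1) z.2.2.1 z.2.2.2).2 r ≠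
      chainState (Gabs S n) (packV S n) (S.R n) z.2.1 (x0A S n qn A₀ z.2.2.1).1 (x0A S n qn A₀ z.2.2.1).2 r ∧
    Gabs S n z.1 (chainState (Gabs S n) (packV S n) (S.R n) (Function.update z.2.1 r z.1)
        (AA S n qn κ A₀ A (Function.update z.2.1 r z.1) z.2.2.1 z.2.2.2).1 (AA S n qn κ A₀ A (Function.update z.2.1 r z.1) z.2.2.1 z.2.2.2).2 r) =
      Gabs S n z.1 (chainState (Gabs S n) (packV S n) (S.R n) z.2.1 (x0A S n qn A₀ z.2.2.1).1 (x0A S n qn A₀ z.2.2.1).2 r))).card : ℝ) *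
          Fintype.card (List.Vector Bool (jkLen S q n)) ≤
        ∑ t : List.Vector Bool qn × (((Fin (S.R n + 1) → Yv S n) × List.Vector Bool (loLen S n)) × List.Vector Bool (jkLen S q n)),
          ∑ y : Yv S n, ∑ ω : List.Vector Bool κ, IB ⟨(RBC S q n).enc (rbOfR S n r, t), (RBC S q n).length_enc _⟩ y ω := by
    intro r
    -- the level indicator is below `IB`
    have hle : ∀ (t : List.Vector Bool qn × (((Fin (S.R n + 1) → Yv S n) × List.Vector Bool (loLen S n)) × List.Vector Bool (jkLen S q n)))
        (y : Yv S n) (ω : List.Vector Bool κ), (if (chainState (Gabs S n) (packV S n) (S.R n) (Function.update (y, t.2.1.1, (t.1, t.2.1.2), ω).2.1 r (y, t.2.1.1, (t.1, t.2.1.2), ω).1)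
        (AA S n qn κ A₀ A (Function.update (y, t.2.1.1, (t.1, t.2.1.2), ω).2.1 r (y, t.2.1.1, (t.1, t.2.1.2), ω).1) (y, t.2.1.1, (t.1, t.2.1.2), ω).2.2.1 (y, t.2.1.1, (t.1, t.2.1.2), ω).2.2.2).1 (AA S n qn κ A₀ A (Function.update (y, t.2.1.1, (t.1, t.2.1.2), ω).2.1 r (y, t.2.1.1, (t.1, t.2.1.2), ω).1) (y, t.2.1.1, (t.1, t.2.1.2), ω).2.2.1 (y, t.2.1.1, (t.1, t.2.1.2), ω).2.2.2).2 r ≠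
      chainState (Gabs S n) (packV S n) (S.R n) (y, t.2.1.1, (t.1, t.2.1.2), ω).2.1 (x0A S n qn A₀ (y, t.2.1.1, (t.1, t.2.1.2), ω).2.2.1).1 (x0A S n qn A₀ (y, t.2.1.1, (t.1, t.2.1.2), ω).2.2.1).2 r ∧
    Gabs S n (y, t.2.1.1, (t.1, t.2.1.2), ω).1 (chainState (Gabs S n) (packV S n) (S.R n) (Function.update (y, t.2.1.1, (t.1, t.2.1.2), ω).2.1 r (y, t.2.1.1, (t.1, t.2.1.2), ω).1)
        (AA S n qn κ A₀ A (Function.update (y, t.2.1.1, (t.1, t.2.1.2), ω).2.1 r (y, t.2.1.1, (t.1, t.2.1.2), ω).1) (y, t.2.1.1, (t.1, t.2.1.2), ω).2.2.1 (y, t.2.1.1, (t.1, t.2.1.2), ω).2.2.2).1 (AA S n qn κ A₀ A (Function.update (y, t.2.1.1, (t.1, t.2.1.2), ω).2.1 r (y, t.2.1.1, (t.1, t.2.1.2), ω).1) (y, t.2.1.1, (t.1, t.2.1.2), ω).2.2.1 (y, t.2.1.1, (t.1, t.2.1.2), ω).2.2.2).2 r) =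
      Gabs S n (y, t.2.1.1, (t.1, t.2.1.2), ω).1 (chainState (Gabs S n) (packV S n) (S.R n) (y, t.2.1.1, (t.1, t.2.1.2), ω).2.1 (x0A S n qn A₀ (y, t.2.1.1, (t.1, t.2.1.2), ω).2.2.1).1 (x0A S n qn A₀ (y, t.2.1.1, (t.1, t.2.1.2), ω).2.2.1).2 r)) then (1 : ℝ) else 0) ≤
          IB ⟨(RBC S q n).enc (rbOfR S n r, t), (RBC S q n).length_enc _⟩ y ω := by
      rintro ⟨ρ, ⟨keys, lo⟩, jk⟩ y ω
      refine ite_le_ite_of_imp fun hP => ?_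
      simp only [List.Vector.toList_mk, hrun1]
      exact collision_of_level_success hS (hdB n) r y keys lo ρ jk ω (by simpa only using hP)
    -- and its sum is `|V_jk| · #P r`
    have hsum : ∑ t : List.Vector Bool qn × (((Fin (S.R n + 1) → Yv S n) × List.Vector Bool (loLen S n)) × List.Vector Bool (jkLen S q n)),
        ∑ y : Yv S n, ∑ ω : List.Vector Bool κ, (if (chainState (Gabs S n) (packV S n) (S.R n) (Function.update (y, t.2.1.1, (t.1, t.2.1.2), ω).2.1 r (y, t.2.1.1, (t.1, t.2.1.2), ω).1)
        (AA S n qn κ A₀ A (Function.update (y, t.2.1.1, (t.1, t.2.1.2), ω).2.1 r (y, t.2.1.1, (t.1, t.2.1.2), ω).1) (y, t.2.1.1, (t.1, t.2.1.2), ω).2.2.1 (y, t.2.1.1, (t.1, t.2.1.2), ω).2.2.2).1 (AA S n qn κ A₀ A (Function.update (y, t.2.1.1, (t.1, t.2.1.2), ω).2.1 r (y, t.2.1.1, (t.1, t.2.1.2), ω).1) (y, t.2.1.1, (t.1, t.2.1.2), ω).2.2.1 (y, t.2.1.1, (t.1, t.2.1.2), ω).2.2.2).2 r ≠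
      chainState (Gabs S n) (packV S n) (S.R n) (y, t.2.1.1, (t.1, t.2.1.2), ω).2.1 (x0A S n qn A₀ (y, t.2.1.1, (t.1, t.2.1.2), ω).2.2.1).1 (x0A S n qn A₀ (y, t.2.1.1, (t.1, t.2.1.2), ω).2.2.1).2 r ∧
    Gabs S n (y, t.2.1.1, (t.1, t.2.1.2), ω).1 (chainState (Gabs S n) (packV S n) (S.R n) (Function.update (y, t.2.1.1, (t.1, t.2.1.2), ω).2.1 r (y, t.2.1.1, (t.1, t.2.1.2), ω).1)
        (AA S n qn κ A₀ A (Function.update (y, t.2.1.1, (t.1, t.2.1.2), ω).2.1 r (y, t.2.1.1, (t.1, t.2.1.2), ω).1) (y, t.2.1.1, (t.1, t.2.1.2), ω).2.2.1 (y, t.2.1.1, (t.1, t.2.1.2), ω).2.2.2).1 (AA S n qn κ A₀ A (Function.update (y, t.2.1.1, (t.1, t.2.1.2), ω).2.1 r (y, t.2.1.1, (t.1, t.2.1.2), ω).1) (y, t.2.1.1, (t.1, t.2.1.2), ω).2.2.1 (y, t.2.1.1, (t.1, t.2.1.2), ω).2.2.2).2 r) =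
      Gabs S n (y, t.2.1.1, (t.1, t.2.1.2), ω).1 (chainState (Gabs S n) (packV S n) (S.R n) (y, t.2.1.1, (t.1, t.2.1.2), ω).2.1 (x0A S n qn A₀ (y, t.2.1.1, (t.1, t.2.1.2), ω).2.2.1).1 (x0A S n qn A₀ (y, t.2.1.1, (t.1, t.2.1.2), ω).2.2.1).2 r)) then (1 : ℝ) else 0) =
        (((univ : Finset (Yv S n × (Fin (S.R n + 1) → Yv S n) × CoinsR S n qn × List.Vector Bool κ)).filter fun z =>
      (chainState (Gabs S n) (packV S n) (S.R n) (Function.update z.2.1 r z.1)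
        (AA S n qn κ A₀ A (Function.update z.2.1 r z.1) z.2.2.1 z.2.2.2).1 (AA S n qn κ A₀ A (Function.update z.2.1 r z.1) z.2.2.1 z.2.2.2).2 r ≠
      chainState (Gabs S n) (packV S n) (S.R n) z.2.1 (x0A S n qn A₀ z.2.2.1).1 (x0A S n qn A₀ z.2.2.1).2 r ∧
    Gabs S n z.1 (chainState (Gabs S n) (packV S n) (S.R n) (Function.update z.2.1 r z.1)
        (AA S n qn κ A₀ A (Function.update z.2.1 r z.1) z.2.2.1 z.2.2.2).1 (AA S n qn κ A₀ A (Function.update z.2.1 r z.1) z.2.2.1 z.2.2.2).2 r) =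
      Gabs S n z.1 (chainState (Gabs S n) (packV S n) (S.R n) z.2.1 (x0A S n qn A₀ z.2.2.1).1 (x0A S n qn A₀ z.2.2.1).2 r))).card : ℝ) *
          Fintype.card (List.Vector Bool (jkLen S q n)) := by
      rw [mul_comm, ← Fintype.sum_prod_type', ← Fintype.sum_prod_type',
        Fintype.sum_equiv (reixB S q n κ) _ (fun w => if (chainState (Gabs S n) (packV S n) (S.R n) (Function.update w.2.2.1 r w.2.1)
        (AA S n qn κ A₀ A (Function.update w.2.2.1 r w.2.1) w.2.2.2.1 w.2.2.2.2).1 (AA S n qn κ A₀ A (Function.update w.2.2.1 r w.2.1) w.2.2.2.1 w.2.2.2.2).2 r ≠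
      chainState (Gabs S n) (packV S n) (S.R n) w.2.2.1 (x0A S n qn A₀ w.2.2.2.1).1 (x0A S n qn A₀ w.2.2.2.1).2 r ∧
    Gabs S n w.2.1 (chainState (Gabs S n) (packV S n) (S.R n) (Function.update w.2.2.1 r w.2.1)
        (AA S n qn κ A₀ A (Function.update w.2.2.1 r w.2.1) w.2.2.2.1 w.2.2.2.2).1 (AA S n qn κ A₀ A (Function.update w.2.2.1 r w.2.1) w.2.2.2.1 w.2.2.2.2).2 r) =
      Gabs S n w.2.1 (chainState (Gabs S n) (packV S n) (S.R n) w.2.2.1 (x0A S n qn A₀ w.2.2.2.1).1 (x0A S n qn A₀ w.2.2.2.1).2 r)) then (1 : ℝ) else 0) (by rintro ⟨⟨⟨ρ, ⟨keys, lo⟩, jk⟩, y⟩, ω⟩; rfl)]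
      exact sum_ite_snd_eq (P := fun (z : Yv S n × (Fin (S.R n + 1) → Yv S n) × CoinsR S n qn × List.Vector Bool κ) => (chainState (Gabs S n) (packV S n) (S.R n) (Function.update z.2.1 r z.1)
        (AA S n qn κ A₀ A (Function.update z.2.1 r z.1) z.2.2.1 z.2.2.2).1 (AA S n qn κ A₀ A (Function.update z.2.1 r z.1) z.2.2.1 z.2.2.2).2 r ≠
      chainState (Gabs S n) (packV S n) (S.R n) z.2.1 (x0A S n qn A₀ z.2.2.1).1 (x0A S n qn A₀ z.2.2.1).2 r ∧
    Gabs S n z.1 (chainState (Gabs S n) (packV S n) (S.R n) (Function.update z.2.1 r z.1)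
        (AA S n qn κ A₀ A (Function.update z.2.1 r z.1) z.2.2.1 z.2.2.2).1 (AA S n qn κ A₀ A (Function.update z.2.1 r z.1) z.2.2.1 z.2.2.2).2 r) =
      Gabs S n z.1 (chainState (Gabs S n) (packV S n) (S.R n) z.2.1 (x0A S n qn A₀ z.2.2.1).1 (x0A S n qn A₀ z.2.2.1).2 r)))
    rw [← hsum]
    exact Finset.sum_le_sum fun t _ => Finset.sum_le_sum fun y _ => Finset.sum_le_sum fun ω _ => hle t y ω
  have h7 : ∑ r : Fin (S.R n + 1), ∑ t : List.Vector Bool qn × (((Fin (S.R n + 1) → Yv S n) × List.Vector Bool (loLen S n)) × List.Vector Bool (jkLen S q n)),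
        ∑ y : Yv S n, ∑ ω : List.Vector Bool κ, IB ⟨(RBC S q n).enc (rbOfR S n r, t), (RBC S q n).length_enc _⟩ y ω ≤
      ∑ rB : List.Vector Bool (RBC S q n).len, ∑ y : Yv S n, ∑ ω : List.Vector Bool κ, IB rB y ω := by
    have hnn : ∀ rB y ω, 0 ≤ IB rB y ω := fun rB y ω => by simp only [IB]; split_ifs <;> norm_num
    rw [(RBC S q n).sum_vector_eq (fun l => ∑ y : Yv S n, ∑ ω : List.Vector Bool κ,
      if (base S).IsRestrictedCollision dB ((base S).index.run n y.toList, B0P S q A₀ l,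
        (redB S q A).run (boolPair (unaryEncodeNat n) (boolPair ((base S).index.run n y.toList) l)) ω.toList) then (1 : ℝ) else 0),
      Fintype.sum_prod_type]
    calc ∑ r : Fin (S.R n + 1), ∑ t, ∑ y : Yv S n, ∑ ω : List.Vector Bool κ, IB ⟨(RBC S q n).enc (rbOfR S n r, t), (RBC S q n).length_enc _⟩ y ω
        = ∑ rb ∈ (univ : Finset (Fin (S.R n + 1))).image (rbOfR S n), ∑ t, ∑ y : Yv S n, ∑ ω : List.Vector Bool κ,
            IB ⟨(RBC S q n).enc (rb, t), (RBC S q n).length_enc _⟩ y ω := by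
          rw [Finset.sum_image fun r _ r' _ h => rbOfR_injective h]
      _ ≤ ∑ rb : List.Vector Bool (aRb S n), ∑ t, ∑ y : Yv S n, ∑ ω : List.Vector Bool κ, IB ⟨(RBC S q n).enc (rb, t), (RBC S q n).length_enc _⟩ y ω :=
          Finset.sum_le_sum_of_subset_of_nonneg (Finset.subset_univ _) fun rb _ _ =>
            Finset.sum_nonneg fun t _ => Finset.sum_nonneg fun y _ => Finset.sum_nonneg fun ω _ => hnn _ _ _
      _ = _ := Finset.sum_congr rfl fun rb _ => Finset.sum_congr rfl fun t _ => rfl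
  -- Step 7: assemble with the cardinalities
  have hY : (Fintype.card (Yv S n) : ℝ) = 2 ^ S.p.eval n := by rw [card_vector, Fintype.card_bool]; push_cast; ring
  have hJ : (Fintype.card (List.Vector Bool (jkLen S q n)) : ℝ) = 2 ^ jkLen S q n := by rw [card_vector, Fintype.card_bool]; push_cast; ring
  have hRBC : (2 : ℝ) ^ (RBC S q n).len = 2 ^ aRb S n * (2 ^ qn * 2 ^ (KCL S n).len * 2 ^ jkLen S q n) := by
    rw [show (RBC S q n).len = aRb S n + (qn + ((KCL S n).len + jkLen S q n)) from rfl]; simp only [pow_add]; ring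
  have hY0 : (0 : ℝ) < 2 ^ S.p.eval n := by positivity
  have hJ0 : (0 : ℝ) < 2 ^ jkLen S q n := by positivity
  -- the chain in `ℝ`
  have hA : (∑ ρ : List.Vector Bool qn, ∑ ys : List.Vector Bool (KCL S n).len, ∑ ω : List.Vector Bool κ, IS ρ ys ω) * (2 ^ S.p.eval n * 2 ^ jkLen S q n) ≤
      ∑ rB : List.Vector Bool (RBC S q n).len, ∑ y : Yv S n, ∑ ω : List.Vector Bool κ, IB rB y ω := by
    have h4R : (C₀ : ℝ) * 2 ^ S.p.eval n ≤ ∑ r : Fin (S.R n + 1),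
        (((univ : Finset (Yv S n × (Fin (S.R n + 1) → Yv S n) × CoinsR S n qn × List.Vector Bool κ)).filter fun z =>
      (chainState (Gabs S n) (packV S n) (S.R n) (Function.update z.2.1 r z.1)
        (AA S n qn κ A₀ A (Function.update z.2.1 r z.1) z.2.2.1 z.2.2.2).1 (AA S n qn κ A₀ A (Function.update z.2.1 r z.1) z.2.2.1 z.2.2.2).2 r ≠
      chainState (Gabs S n) (packV S n) (S.R n) z.2.1 (x0A S n qn A₀ z.2.2.1).1 (x0A S n qn A₀ z.2.2.1).2 r ∧
    Gabs S n z.1 (chainState (Gabs S n) (packV S n) (S.R n) (Function.update z.2.1 r z.1)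
        (AA S n qn κ A₀ A (Function.update z.2.1 r z.1) z.2.2.1 z.2.2.2).1 (AA S n qn κ A₀ A (Function.update z.2.1 r z.1) z.2.2.1 z.2.2.2).2 r) =
      Gabs S n z.1 (chainState (Gabs S n) (packV S n) (S.R n) z.2.1 (x0A S n qn A₀ z.2.2.1).1 (x0A S n qn A₀ z.2.2.1).2 r))).card : ℝ) := by
      rw [← hY]; exact_mod_cast h4
    calc (∑ ρ : List.Vector Bool qn, ∑ ys : List.Vector Bool (KCL S n).len, ∑ ω : List.Vector Bool κ, IS ρ ys ω) * (2 ^ S.p.eval n * 2 ^ jkLen S q n)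
        ≤ (C₀ : ℝ) * 2 ^ S.p.eval n * 2 ^ jkLen S q n := by rw [← mul_assoc]; exact mul_le_mul_of_nonneg_right (mul_le_mul_of_nonneg_right h3 hY0.le) hJ0.le
      _ ≤ (∑ r : Fin (S.R n + 1), (((univ : Finset (Yv S n × (Fin (S.R n + 1) → Yv S n) × CoinsR S n qn × List.Vector Bool κ)).filter fun z =>
      (chainState (Gabs S n) (packV S n) (S.R n) (Function.update z.2.1 r z.1)
        (AA S n qn κ A₀ A (Function.update z.2.1 r z.1) z.2.2.1 z.2.2.2).1 (AA S n qn κ A₀ A (Function.update z.2.1 r z.1) z.2.2.1 z.2.2.2).2 r ≠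
      chainState (Gabs S n) (packV S n) (S.R n) z.2.1 (x0A S n qn A₀ z.2.2.1).1 (x0A S n qn A₀ z.2.2.1).2 r ∧
    Gabs S n z.1 (chainState (Gabs S n) (packV S n) (S.R n) (Function.update z.2.1 r z.1)
        (AA S n qn κ A₀ A (Function.update z.2.1 r z.1) z.2.2.1 z.2.2.2).1 (AA S n qn κ A₀ A (Function.update z.2.1 r z.1) z.2.2.1 z.2.2.2).2 r) =
      Gabs S n z.1 (chainState (Gabs S n) (packV S n) (S.R n) z.2.1 (x0A S n qn A₀ z.2.2.1).1 (x0A S n qn A₀ z.2.2.1).2 r))).card : ℝ)) *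
            2 ^ jkLen S q n := mul_le_mul_of_nonneg_right h4R hJ0.le
      _ = ∑ r : Fin (S.R n + 1), (((univ : Finset (Yv S n × (Fin (S.R n + 1) → Yv S n) × CoinsR S n qn × List.Vector Bool κ)).filter fun z =>
      (chainState (Gabs S n) (packV S n) (S.R n) (Function.update z.2.1 r z.1)
        (AA S n qn κ A₀ A (Function.update z.2.1 r z.1) z.2.2.1 z.2.2.2).1 (AA S n qn κ A₀ A (Function.update z.2.1 r z.1) z.2.2.1 z.2.2.2).2 r ≠
      chainState (Gabs S n) (packV S n) (S.R n) z.2.1 (x0A S n qn A₀ z.2.2.1).1 (x0A S n qn A₀ z.2.2.1).2 r ∧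
    Gabs S n z.1 (chainState (Gabs S n) (packV S n) (S.R n) (Function.update z.2.1 r z.1)
        (AA S n qn κ A₀ A (Function.update z.2.1 r z.1) z.2.2.1 z.2.2.2).1 (AA S n qn κ A₀ A (Function.update z.2.1 r z.1) z.2.2.1 z.2.2.2).2 r) =
      Gabs S n z.1 (chainState (Gabs S n) (packV S n) (S.R n) z.2.1 (x0A S n qn A₀ z.2.2.1).1 (x0A S n qn A₀ z.2.2.1).2 r))).card : ℝ) *
            Fintype.card (List.Vector Bool (jkLen S q n)) := by rw [hJ, Finset.sum_mul]
      _ ≤ _ := (Finset.sum_le_sum fun r _ => h6 r).trans h7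
  rw [h1, h5, div_le_iff₀ (by positivity)]
  have key : ∀ {X Y a b c p j A2 : ℝ}, 0 < A2 → 0 < p → 0 < j → 0 < a → 0 < b → 0 < c → X * (p * j) ≤ Y →
      X ≤ A2 * (Y / (A2 * (a * b * j) * p * c)) * (a * b * c) := by
    intro X Y a b c p j A2 hA2 hp hj ha hb hc h
    have : A2 * (Y / (A2 * (a * b * j) * p * c)) * (a * b * c) = Y / (p * j) := by field_simp
    rw [this, le_div_iff₀ (mul_pos hp hj)]; exact h
  have hX := key (X := ∑ ρ : List.Vector Bool qn, ∑ ys : List.Vector Bool (KCL S n).len, ∑ ω : List.Vector Bool κ, IS ρ ys ω)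
    (by positivity : (0 : ℝ) < (2 : ℝ) ^ aRb S n) hY0 hJ0 (by positivity : (0:ℝ) < 2 ^ qn) (by positivity : (0:ℝ) < 2 ^ (KCL S n).len)
    (by positivity : (0:ℝ) < 2 ^ κ) hA
  rw [hRBC]
  exact hX

end Count

/-! ### Negligibility and leveled restricted UOWHFs -/

section Leveled

/-- **A leveled restricted UOWHF**: efficient, of range `rI(|s|)` on the domain `{0,1}^{dI(|s|)}`, and such that
every two-stage PPT adversary forms a designated collision inside the domain only with negligible probability.
(Goldreich's Def. 6.4.19 minus its condition (1) on the index length, which the `p`-shaped families replace by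
"indices at parameter `n` have length `p(n) + n + 1`"; the renormalisation to `|s| = n` is a separate step.)
[cite: Goldreich2004, Def. 6.4.19 (2)–(3)] -/
def _root_.Literature.Computability.Cryptography.HashCollection.IsLeveledRUOWHF (H : HashCollection) (dI rI : ℕ → ℕ) : Prop :=
  H.IsEfficient ∧ (∀ s x : List Bool, x.length = dI s.length → (H.hash s x).length = rI s.length) ∧
    ∀ q : Polynomial ℕ, ∀ A₀ : List Bool → List Bool, A₀ ∈ FP → ∀ A : RandAlg (List Bool) (List Bool), IsPPT A id →
      SuperpolynomialDecay atTop (fun n : ℕ => (n : ℝ)) (H.rtcrProb dI (fun m => q.eval m) A₀ A)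

variable {S : Spec}

/-- `2^{|bin R|} ≤ 2·P_R(n) + 1`. [folklore] -/
theorem two_pow_aRb_le (hS : S.WF) (n : ℕ) : 2 ^ aRb S n ≤ (C 2 * S.PR + 1).eval n := by
  have h1 : 2 ^ aRb S n ≤ 2 * S.R n + 1 := UExpr.pow2_le (fun _ => S.R n) (UExpr.var 0)
  have h2 := hS.R_le n
  simp only [eval_add, eval_mul, eval_C, eval_one]; omega

/-- **Negligibility transfers through the composition.** [cite: Goldreich2004, Prop. 6.4.23] -/
theorem superpolynomialDecay_rtcrProb_compose (hS : S.WF) {dB : ℕ → ℕ} (hdB : ∀ n, dB (LenPres.M S.p n) = S.dL n)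
    (hbase : ∀ q' : Polynomial ℕ, ∀ B₀ : List Bool → List Bool, B₀ ∈ FP → ∀ B : RandAlg (List Bool) (List Bool), IsPPT B id →
      SuperpolynomialDecay atTop (fun n : ℕ => (n : ℝ)) ((base S).rtcrProb dB (fun m => q'.eval m) B₀ B))
    (q : Polynomial ℕ) {A₀ : List Bool → List Bool} (hA₀ : A₀ ∈ FP) {A : RandAlg (List Bool) (List Bool)} (hA : IsPPT A id) :
    SuperpolynomialDecay atTop (fun n : ℕ => (n : ℝ)) ((compose S).rtcrProb (dLenC S) (fun m => q.eval m) A₀ A) := by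
  have hneg := hbase (QB S q) (B0P S q A₀) (B0P_mem_FP S q A₀ hS hA₀) (redB S q A) (isPPT_redB hS hA)
  have hpoly : SuperpolynomialDecay atTop (fun n : ℕ => (n : ℝ))
      (fun n => (((C 2 * S.PR + 1).eval n : ℕ) : ℝ) * (base S).rtcrProb dB (fun m => (QB S q).eval m) (B0P S q A₀) (redB S q A) n) := by
    refine (hneg.polynomial_mul ((C 2 * S.PR + 1).map (Nat.castRingHom ℝ))).congr fun n => ?_
    rw [Polynomial.eval_map, Polynomial.eval₂_at_natCast]
    simp only [eq_natCast, Nat.cast_id]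
  refine hpoly.trans_abs_le fun n => ?_
  have h0 := HashCollection.rtcrProb_nonneg (base S) dB (fun m => (QB S q).eval m) (B0P S q A₀) (redB S q A) n
  rw [abs_of_nonneg (HashCollection.rtcrProb_nonneg _ _ _ _ _ _), abs_of_nonneg (mul_nonneg (Nat.cast_nonneg _) h0)]
  refine (rtcrProb_compose_le hS hdB n).trans (mul_le_mul_of_nonneg_right ?_ h0)
  exact_mod_cast two_pow_aRb_le hS n

/-- **The composition of a leveled restricted UOWHF is a leveled restricted UOWHF** (Goldreich's Prop. 6.4.23 in the
form our families support): from `(dI, ·)` on the basic `p`-shaped family with `dI(M_p(n)) = dL(n)` to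
`(dL + R, dL − 1)` at the level of the composed index. [cite: Goldreich2004, Prop. 6.4.23] -/
theorem isLeveledRUOWHF_compose (hS : S.WF) {dB rB : ℕ → ℕ} (hdB : ∀ n, dB (LenPres.M S.p n) = S.dL n)
    (hbase : (base S).IsLeveledRUOWHF dB rB) : (compose S).IsLeveledRUOWHF (dLenC S) (rLenC S) :=
  ⟨isEfficient_compose S hS, fun s x _ => length_compose_hash S hS s x,
    fun q _ hA₀ _ hA => superpolynomialDecay_rtcrProb_compose hS hdB hbase.2.2 q hA₀ hA⟩

end Leveled

end MDCompose

end Literature.Computability.Cryptography
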